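import Summits.CriticalPhenomena.PercolationContinuityZ3.Theorems.SahiBoxTP2TiltHilbert
import Summits.CriticalPhenomena.PercolationContinuityZ3.Theorems.SahiBoxTP2Transport

/-!
# Box-TP₂ under continuous log-supermodular tilts: transport along lattice isomorphisms; coupled products

Support file of the Sahi cell (`prim-sahi`, typer seat, generation 14; `--supports stmt-CriticalPhenomena-4575`).
Theorems only (no definitions, no named facts, no sorries).  Companion of `SahiBoxTP2Tilt.lean`.

* `IsBoxTP2.withDensity_of_continuous_of_orderIso` — the tilt theorem on ANY measurable lattice `β` carrying a
  measurable, bi-continuous-enough lattice isomorphism `Φ : β ≃o Q_d` onto a cube: a finite box-TP₂ measure on `β`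
  tilted by a continuous log-supermodular density (continuity w.r.t. the topology making `Φ.symm` continuous) is
  box-TP₂ (`map_withDensity_comp`, `IsBoxTP2.map_orderIso` both ways).
* `IsBoxTP2.prod_withDensity_of_continuous` — **coupling two box-TP₂ systems ferromagnetically keeps box-TP₂**: for
  finite box-TP₂ laws `μ₁` on `Q_{d₁}`, `μ₂` on `Q_{d₂}` and a continuous log-supermodular `ρ` on the product lattice
  `Q_{d₁} × Q_{d₂}`, the measure `ρ · (μ₁ ⊗ μ₂)` is box-TP₂ (product `IsBoxTP2.prod`, then the transported tilt along
  `Fin.append : Q_{d₁} × Q_{d₂} ≃o Q_{d₁+d₂}`); `IsBoxTP2.prod_withDensity_exp_of_submodular` — the Gibbs form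
  `e^{−H(x,y)} μ₁(dx) μ₂(dy)`, `H` continuous submodular (e.g. `H(x,y) = −J Σ x_i y_j`, `J ≥ 0`).

No sorries, no new axioms.
-/

noncomputable section

namespace Summit.CriticalPhenomena.PercolationContinuityZ3.Theorems.SahiBoxTP2

open MeasureTheory Set Filter Topology Function Literature.Combinatorics.Sahi2008
open scoped ENNReal NNReal unitInterval

variable {d d₁ d₂ : ℕ}

/-! ### Transport of the tilt theorem along a lattice isomorphism onto a cube -/

/-- **The tilt theorem transported along a measurable lattice isomorphism onto `Q_d`.**  Let `Φ : β ≃o Q_d` be an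
order isomorphism with `Φ`, `Φ.symm` measurable and `Φ.symm` continuous.  If `μ` is a finite box-TP₂ measure on `β` and
`ρ : β → ℝ≥0` is continuous and log-supermodular, then `ρ · μ` is box-TP₂. [this work] -/
theorem IsBoxTP2.withDensity_of_continuous_of_orderIso {β : Type*} [Lattice β] [MeasurableSpace β]
    [TopologicalSpace β] (Φ : β ≃o (Fin d → I)) (hΦm : Measurable Φ) (hΦs : Measurable Φ.symm)
    (hΦc : Continuous Φ.symm) (μ : Measure β) [IsFiniteMeasure μ] (hμ : IsBoxTP2 μ) {ρ : β → ℝ≥0}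
    (hρc : Continuous ρ) (hρ : ∀ x y, ρ x * ρ y ≤ ρ (x ⊓ y) * ρ (x ⊔ y)) :
    IsBoxTP2 (μ.withDensity fun x => (ρ x : ℝ≥0∞)) := by
  let e : β ≃ᵐ (Fin d → I) := { toEquiv := Φ.toEquiv, measurable_toFun := hΦm, measurable_invFun := hΦs }
  have hΦ : MeasurableEmbedding Φ := e.measurableEmbedding
  have hΦ' : MeasurableEmbedding Φ.symm := e.symm.measurableEmbedding
  haveI : IsFiniteMeasure (μ.map Φ) := Measure.isFiniteMeasure_map μ _
  -- the tilt on the cube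
  have hg : Continuous fun u : Fin d → I => ρ (Φ.symm u) := hρc.comp hΦc
  have hgm : Measurable fun u : Fin d → I => (ρ (Φ.symm u) : ℝ≥0∞) := (ENNReal.continuous_coe.comp hg).measurable
  have htilt : IsBoxTP2 ((μ.map Φ).withDensity fun u => (ρ (Φ.symm u) : ℝ≥0∞)) :=
    (hμ.map_orderIso Φ hΦ).withDensity_of_continuous (μ.map Φ) hg fun u v => by
      rw [Φ.symm.map_inf, Φ.symm.map_sup]; exact hρ _ _
  -- `(ρ μ).map Φ` is that tilt
  have hfac : (fun x : β => (ρ x : ℝ≥0∞)) = (fun u : Fin d → I => (ρ (Φ.symm u) : ℝ≥0∞)) ∘ Φ := by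
    funext x
    simp only [Function.comp_apply, OrderIso.symm_apply_apply]
  have hmapΦ : (μ.withDensity fun x => (ρ x : ℝ≥0∞)).map Φ = (μ.map Φ).withDensity fun u => (ρ (Φ.symm u) : ℝ≥0∞) := by
    rw [hfac, map_withDensity_comp μ hΦ.measurable hgm]
  -- pull back along `Φ.symm`
  have hback : ((μ.withDensity fun x => (ρ x : ℝ≥0∞)).map Φ).map Φ.symm = μ.withDensity fun x => (ρ x : ℝ≥0∞) := by
    rw [Measure.map_map hΦs hΦ.measurable, show (⇑Φ.symm ∘ ⇑Φ) = id from funext Φ.symm_apply_apply,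
      Measure.map_id]
  rw [← hback, hmapΦ]
  exact htilt.map_orderIso Φ.symm hΦ'

/-! ### Coupled products `ρ(x,y) μ₁(dx) μ₂(dy)` -/

/-- `Fin.append` as a map `Q_{d₁} × Q_{d₂} → Q_{d₁+d₂}` is monotone. [folklore] -/
theorem monotone_append_prod {α : Type*} [Preorder α] :
    Monotone fun p : (Fin d₁ → α) × (Fin d₂ → α) => Fin.append p.1 p.2 := by
  intro p q hpq i
  refine Fin.addCases (fun i => ?_) (fun j => ?_) i
  · simp only [Fin.append_left]; exact hpq.1 i
  · simp only [Fin.append_right]; exact hpq.2 j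

/-- Splitting `Q_{d₁+d₂} → Q_{d₁} × Q_{d₂}` is monotone. [folklore] -/
theorem monotone_split_prod {α : Type*} [Preorder α] :
    Monotone fun z : Fin (d₁ + d₂) → α => ((fun i => z (Fin.castAdd d₂ i)), fun j => z (Fin.natAdd d₁ j)) :=
  fun _ _ hzw => ⟨fun _ => hzw _, fun _ => hzw _⟩

/-- **Coupling two box-TP₂ systems by a continuous log-supermodular interaction keeps box-TP₂**: for finite box-TP₂
measures `μ₁` on `Q_{d₁}`, `μ₂` on `Q_{d₂}` and `ρ : Q_{d₁} × Q_{d₂} → ℝ≥0` continuous with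
`ρ p · ρ q ≤ ρ (p ⊓ q) · ρ (p ⊔ q)` (product lattice), the measure `ρ · (μ₁ ⊗ μ₂)` is box-TP₂. [this work] -/
theorem IsBoxTP2.prod_withDensity_of_continuous (μ₁ : Measure (Fin d₁ → I)) (μ₂ : Measure (Fin d₂ → I))
    [IsFiniteMeasure μ₁] [IsFiniteMeasure μ₂] (hμ₁ : IsBoxTP2 μ₁) (hμ₂ : IsBoxTP2 μ₂)
    {ρ : (Fin d₁ → I) × (Fin d₂ → I) → ℝ≥0} (hρc : Continuous ρ) (hρ : ∀ p q, ρ p * ρ q ≤ ρ (p ⊓ q) * ρ (p ⊔ q)) :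
    IsBoxTP2 ((μ₁.prod μ₂).withDensity fun p => (ρ p : ℝ≥0∞)) := by
  -- the lattice isomorphism `Fin.append : Q_{d₁} × Q_{d₂} ≃o Q_{d₁+d₂}`
  let E : (Fin d₁ → I) × (Fin d₂ → I) ≃ (Fin (d₁ + d₂) → I) :=
    { toFun := fun p => Fin.append p.1 p.2
      invFun := fun z => ((fun i => z (Fin.castAdd d₂ i)), fun j => z (Fin.natAdd d₁ j))
      left_inv := fun p => by
        ext i
        · simp only [Fin.append_left]
        · simp only [Fin.append_right]
      right_inv := fun z => Fin.append_castAdd_natAdd }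
  let Φ : (Fin d₁ → I) × (Fin d₂ → I) ≃o (Fin (d₁ + d₂) → I) :=
    E.toOrderIso monotone_append_prod monotone_split_prod
  have hΦm : Measurable Φ := by
    refine measurable_pi_lambda _ fun i => ?_
    refine Fin.addCases (fun i => ?_) (fun j => ?_) i
    · have : (fun p : (Fin d₁ → I) × (Fin d₂ → I) => Φ p (Fin.castAdd d₂ i)) = fun p => p.1 i := by
        funext p; exact Fin.append_left p.1 p.2 i
      rw [this]; exact (measurable_pi_apply i).comp measurable_fst
    · have : (fun p : (Fin d₁ → I) × (Fin d₂ → I) => Φ p (Fin.natAdd d₁ j)) = fun p => p.2 j := by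
        funext p; exact Fin.append_right p.1 p.2 j
      rw [this]; exact (measurable_pi_apply j).comp measurable_snd
  have hΦs : Measurable Φ.symm :=
    (measurable_pi_lambda _ fun i => measurable_pi_apply _).prodMk (measurable_pi_lambda _ fun j => measurable_pi_apply _)
  have hΦc : Continuous Φ.symm :=
    (continuous_pi fun i => continuous_apply _).prodMk (continuous_pi fun j => continuous_apply _)
  haveI : IsFiniteMeasure (μ₁.prod μ₂) := inferInstance
  exact IsBoxTP2.withDensity_of_continuous_of_orderIso Φ hΦm hΦs hΦc (μ₁.prod μ₂) (hμ₁.prod hμ₂) hρc hρ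

/-- **Gibbs coupling of two box-TP₂ systems**: `e^{−H(x,y)} μ₁(dx) μ₂(dy)` is box-TP₂ for `H` continuous and submodular
on `Q_{d₁} × Q_{d₂}` (e.g. the ferromagnetic interaction `H(x,y) = −Σ J_{ij} x_i y_j`, `J_{ij} ≥ 0`). [this work] -/
theorem IsBoxTP2.prod_withDensity_exp_of_submodular (μ₁ : Measure (Fin d₁ → I)) (μ₂ : Measure (Fin d₂ → I))
    [IsFiniteMeasure μ₁] [IsFiniteMeasure μ₂] (hμ₁ : IsBoxTP2 μ₁) (hμ₂ : IsBoxTP2 μ₂)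
    {H : (Fin d₁ → I) × (Fin d₂ → I) → ℝ} (hHc : Continuous H) (hH : ∀ p q, H (p ⊓ q) + H (p ⊔ q) ≤ H p + H q) :
    IsBoxTP2 ((μ₁.prod μ₂).withDensity fun p => ENNReal.ofReal (Real.exp (-H p))) :=
  IsBoxTP2.prod_withDensity_of_continuous μ₁ μ₂ hμ₁ hμ₂ (ρ := fun p => Real.toNNReal (Real.exp (-H p)))
    (continuous_real_toNNReal.comp (Real.continuous_exp.comp hHc.neg)) fun p q => by
      rw [← Real.toNNReal_mul (Real.exp_pos _).le, ← Real.toNNReal_mul (Real.exp_pos _).le, ← Real.exp_add,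
        ← Real.exp_add]
      exact Real.toNNReal_le_toNNReal (Real.exp_le_exp.2 (by linarith [hH p q]))

end Summit.CriticalPhenomena.PercolationContinuityZ3.Theorems.SahiBoxTP2
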